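import Literature.NumberTheory.GaloisRepresentations.LiftTorsor
import Literature.NumberTheory.GaloisRepresentations.DeformationLocalObstruction
import Literature.NumberTheory.GaloisRepresentations.NearlyOrdinaryLiftSection
import HarnessLib

/-!
# Assembling a type-`𝒟` lift from a global lift, local Borel lifts and secondary cochains

Topic `Literature/NumberTheory/GaloisRepresentations`.  The glue between Mazur's obstruction
calculus (`DeformationLiftingObstruction`, `DeformationLocalObstruction`, `LiftTorsor`) and the
universality step (`NearlyOrdinaryLiftSection`) in the relation count for the nearly ordinary
deformation ring `R_𝒟` ([Böc07, Thm. 7.6]; [Maz89, §1.6 Prop. 2]).  For an object `B` of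
`Ĉ_𝒪(k)` with `𝔪_Bⁿ = 0` and a surjection `q : B ↠ R_𝒟/𝔪ⁿ` (`n ≥ 1`) with square-zero kernel
`I`, suppose given

1. a global lift `ρ_B : Γ_F → GL₂(B)` of `ρ_𝒟 mod 𝔪ⁿ` with open kernel, unramified outside `S`
   (output of `exists_lift_of_globalObstruction_eq_zero`);
2. for each `v ∣ p` an upper-triangular lift `ρ_v : Γ_{F_v} → GL₂(B)` of
   `localModPow v n = (noFrame v)⁻¹ ρ_𝒟|_{Γ_{F_v}} (noFrame v) mod 𝔪ⁿ`
   (output of `exists_borelLift_of_localObstruction_eq_zero`);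
3. for each `v ∣ p` a `𝔟(I)`-valued cochain `e_v` and `X_v ∈ M₂(I)` splitting the difference
   cocycle of `ρ_v` and `P_v⁻¹ ρ_B|_{Γ_{F_v}} P_v` up to a coboundary,
   `d = e_v + (X_v − σ·X_v)`, where `P_v = stdSection (noFrame v mod 𝔪ⁿ)` (vanishing of the
   secondary class in `H¹(Γ_{F_v}, ad ⊗ I)/im H¹(Γ_{F_v}, 𝔟 ⊗ I)`).

Then `ρ_B` is upper triangular at every `v ∣ p` in the frame `P_v (1 + X_v)`, which lifts
`noFrame v mod 𝔪ⁿ` (`exists_frame_of_secondary`, by `LiftTorsor.conj_mem_parabolicGL_of_liftDiff_eq`)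
— exactly hypothesis `hNO` of the landed `isDeformation_of_lift` / `exists_section_of_lift`, so
`ρ_B` is a deformation of type `𝒟` and **`q` admits an `𝒪`-algebra section**.  Everything is
proved; no named facts.

## References

* B. Mazur, *Deforming Galois representations*, MSRI Publ. 16 (1989), §1.6 Prop. 2, §1.7.
  [cite: Mazur1989Deforming, §1.6 Prop. 2]
* G. Böckle, *Presentations of universal deformation rings*, LMS LNS 320 (2007), Thm. 7.6.
  [cite: Bockle2007Presentations, Theorem 7.6]
-/

noncomputable section

open scoped NumberField
open Field IsDedekindDomain IsLocalRing Topology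

namespace Literature.NumberTheory.GaloisRepresentations

namespace NearlyOrdinaryDeformationRing

variable {F : Type} [Field F] [NumberField F] {p : ℕ} {𝒪 : Type} [CommRing 𝒪] {k : Type}
  [Field k] [Algebra 𝒪 k] {𝒟 : NearlyOrdinaryDatum F p 𝒪 k}
  (𝓡 : NearlyOrdinaryDeformationRing.{0} 𝒟)

section Assembly

variable {n : ℕ} (B : Deformation.CNLAlgebra 𝒪 k)
  (q : B →ₐ[𝒪] 𝓡.R ⧸ maximalIdeal 𝓡.R ^ n) (hq : Function.Surjective q)
  (hI : ∀ x ∈ RingHom.ker (q : B →+* 𝓡.R ⧸ maximalIdeal 𝓡.R ^ n),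
    ∀ y ∈ RingHom.ker (q : B →+* 𝓡.R ⧸ maximalIdeal 𝓡.R ^ n), x * y = 0)

/-- The frame `P_v = stdSection (noFrame v mod 𝔪ⁿ) ∈ GL₂(B)` at `v`. [folklore] -/
def framePow (v : HeightOneSpectrum (𝓞 F)) : GL (Fin 2) B :=
  LiftingObstruction.stdSection hq hI (𝓡.noFrameModPow v n)

/-- `P_v` lifts `noFrame v mod 𝔪ⁿ`. [folklore] -/
theorem map_framePow (v : HeightOneSpectrum (𝓞 F)) :
    Matrix.GeneralLinearGroup.map (q : B →+* 𝓡.R ⧸ maximalIdeal 𝓡.R ^ n) (𝓡.framePow B q hq hI v) =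
      𝓡.noFrameModPow v n :=
  LiftingObstruction.map_stdSection hq hI _

/-- `ρ_B|_{Γ_{F_v}}` in the frame `P_v`: `σ ↦ P_v⁻¹ ρ_B(σ) P_v`. [folklore] -/
def localConj (ρB : absoluteGaloisGroup F →* GL (Fin 2) B) (v : HeightOneSpectrum (𝓞 F)) :
    absoluteGaloisGroup (v.adicCompletion F) →* GL (Fin 2) B :=
  (MulAut.conj (𝓡.framePow B q hq hI v)⁻¹).toMonoidHom.comp (Deformation.toLocal v ρB)

/-- Unfolding `localConj`. [folklore] -/
theorem localConj_apply (ρB : absoluteGaloisGroup F →* GL (Fin 2) B) (v : HeightOneSpectrum (𝓞 F))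
    (σ : absoluteGaloisGroup (v.adicCompletion F)) :
    𝓡.localConj B q hq hI ρB v σ =
      (𝓡.framePow B q hq hI v)⁻¹ * ρB (absGaloisRestrict F (v.adicCompletion F) σ) *
        𝓡.framePow B q hq hI v := by
  simp [localConj, Deformation.toLocal]

/-- `localConj` lifts `localModPow v n` when `ρ_B` lifts `ρ_𝒟 mod 𝔪ⁿ`. [folklore] -/
theorem map_localConj (ρB : absoluteGaloisGroup F →* GL (Fin 2) B)
    (hρB : ∀ σ, Matrix.GeneralLinearGroup.map (q : B →+* 𝓡.R ⧸ maximalIdeal 𝓡.R ^ n) (ρB σ) =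
      𝓡.modPow n σ)
    (v : HeightOneSpectrum (𝓞 F)) (σ : absoluteGaloisGroup (v.adicCompletion F)) :
    Matrix.GeneralLinearGroup.map (q : B →+* 𝓡.R ⧸ maximalIdeal 𝓡.R ^ n)
        (𝓡.localConj B q hq hI ρB v σ) = 𝓡.localModPow v n σ := by
  rw [localConj_apply, map_mul, map_mul, map_inv, map_framePow, hρB, localModPow_eq_conj,
    modPow_apply]

variable (ρB : absoluteGaloisGroup F →* GL (Fin 2) B)
  (hsec : ∀ v : HeightOneSpectrum (𝓞 F), (p : 𝓞 F) ∈ v.asIdeal →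
    ∃ (ρv : absoluteGaloisGroup (v.adicCompletion F) →* GL (Fin 2) B)
      (e : absoluteGaloisGroup (v.adicCompletion F) → Matrix (Fin 2) (Fin 2) B)
      (X : Matrix (Fin 2) (Fin 2) B),
      (∀ σ, Matrix.GeneralLinearGroup.map (q : B →+* 𝓡.R ⧸ maximalIdeal 𝓡.R ^ n) (ρv σ) =
        𝓡.localModPow v n σ) ∧
      (∀ σ, (ρv σ : Matrix (Fin 2) (Fin 2) B) 1 0 = 0) ∧
      (∀ σ, e σ ∈ LiftingObstruction.kerParabolic (id : Fin 2 → Fin 2)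
        (q : B →+* 𝓡.R ⧸ maximalIdeal 𝓡.R ^ n)) ∧
      X ∈ LiftingObstruction.kerMatrix (q : B →+* 𝓡.R ⧸ maximalIdeal 𝓡.R ^ n) ∧
      ∀ σ, LiftingObstruction.liftDiff ρv (𝓡.localConj B q hq hI ρB v) σ =
        e σ + (X - (LiftingObstruction.stdSection hq hI (𝓡.localModPow v n σ) :
          Matrix (Fin 2) (Fin 2) B) * X *
          ((LiftingObstruction.stdSection hq hI (𝓡.localModPow v n σ))⁻¹ : GL (Fin 2) B)))

include hsec in
/-- **The frames.**  Under hypothesis 3, `ρ_B|_{Γ_{F_v}}` is upper triangular in the frame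
`P_v (1 + X_v)`, which lifts `noFrame v mod 𝔪ⁿ`. [cite: Mazur1989Deforming, §1.7] -/
theorem exists_frame_of_secondary (v : HeightOneSpectrum (𝓞 F)) (hv : (p : 𝓞 F) ∈ v.asIdeal) :
    ∃ P : GL (Fin 2) B,
      Matrix.GeneralLinearGroup.map (q : B →+* 𝓡.R ⧸ maximalIdeal 𝓡.R ^ n) P =
        Matrix.GeneralLinearGroup.map (Ideal.Quotient.mk (maximalIdeal 𝓡.R ^ n)) (𝓡.noFrame v) ∧
      ∀ σ, (P⁻¹ * ρB (absGaloisRestrict F (v.adicCompletion F) σ) * P).val 1 0 = 0 := by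
  obtain ⟨ρv, e, X, hρv, hρvup, he, hX, hd⟩ := hsec v hv
  refine ⟨𝓡.framePow B q hq hI v * LiftingObstruction.unitOfKer hI X hX, ?_, fun σ => ?_⟩
  · rw [map_mul, LiftingObstruction.map_unitOfKer, mul_one, map_framePow]
    rfl
  · have hmem := LiftingObstruction.conj_mem_parabolicGL_of_liftDiff_eq hI
      (LiftingObstruction.map_stdSection hq hI) hρv (id : Fin 2 → Fin 2)
      (fun σ => (LiftingObstruction.mem_parabolicGL_id_fin_two_iff _).mpr (hρvup σ))
      e he X hX hd σ
    rw [LiftingObstruction.mem_parabolicGL_id_fin_two_iff, localConj_apply] at hmem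
    have e1 : (𝓡.framePow B q hq hI v * LiftingObstruction.unitOfKer hI X hX)⁻¹ *
        ρB (absGaloisRestrict F (v.adicCompletion F) σ) *
        (𝓡.framePow B q hq hI v * LiftingObstruction.unitOfKer hI X hX) =
        (LiftingObstruction.unitOfKer hI X hX)⁻¹ *
          ((𝓡.framePow B q hq hI v)⁻¹ * ρB (absGaloisRestrict F (v.adicCompletion F) σ) *
            𝓡.framePow B q hq hI v) * LiftingObstruction.unitOfKer hI X hX := by
      group
    rw [e1]
    exact hmem

/- USAGE.  With `hNO := fun v hv => 𝓡.exists_frame_of_secondary B q hq hI ρB hsec v hv`, the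
landed `isDeformation_of_lift hn B q ρB hρB hopen hur hNO` shows that `ρ_B` is a deformation of
type `𝒟`, and `exists_section_of_lift hn B q ρB hρB hopen hur hNO hmB` gives the `𝒪`-algebra
section of `q` (no separate restatement is kept here, by the tree's dedup rule). -/

end Assembly

end NearlyOrdinaryDeformationRing

end Literature.NumberTheory.GaloisRepresentations
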